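import Summits.CriticalPhenomena.PercolationContinuityZ3.Theorems.Transplant.SiteVdBHKTwoCluster
import Literature.Probability.LatticeModels.ProdBernoulliIndependence
import Literature.Probability.Percolation.TwoSetConditionalAssociation
import HarnessLib

/-!
# SITE percolation: Theorems 1.5 / 1.4 / 1.3 of van den Berg–Häggström–Kahn with vertex SETS `S, T`
# (lane `prim-bschramm`, class C1a; site version of `Literature/…/TwoSetConditionalAssociation.lean`)

builds on p205010 (kernel theorem, internal audit signed; external expert review pending).

The p205010 chain consumes vdBHK's two-cluster inequality WITH VERTEX SETS (Thm 1.4 for `C_S`,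
`C_T` given `{S ↮ T}`: links (K6) `CSH.covTransfer_relaySet_edge`, (★^H), `Y^H ≤ H`, CHAIN-READ
§3.5–§3.6; bond tree decl `BHK2006_twoSetConditionalAssociation(.negCorrelation)`).  This file
proves the SITE versions (OUR theorems; the printed Thm 2.1 / Remark 1 are bond / random-cluster
only) from the site one-vertex theorems (`SiteBHK2.siteTwoClusterCondAssoc`, part IV) by the HUB
construction, which for site percolation is literally BHK's "identify the vertices of the set":
pass to `V ⊕ Bool` with two hub vertices `s* = inr true ∼` every vertex of `S` and
`t* = inr false ∼` every vertex of `T`, both of weight `1` (`hubGraph`, `hubQ`; the side function `sides S T` is the tree's, `TwoSetConditionalAssociation.lean`); then a.s. the hubs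
are open, the law of the old coordinates is `prodBernoulli q` (`map_resV_prodBernoulli_hubQ`), so
integrals transport (`setIntegral_hub`, `measureReal_hub`); `{s* ↮ t*}` pulls back to
`{S ↮ T} = {∀ s ∈ S, ∀ t ∈ T, t ∉ C_s}`, and on it the site clusters of the hubs read on `V` are
`C_S = ⋃_{s∈S} C_s` and `C_T` (`resV_siteCluster_hub`).

* `SiteBHK3.siteTwoSetCondAssoc` — site Thm 1.5 with sets;
* `SiteBHK3.siteTwoSet_negCorrelation` — site Thm 1.4 with sets (the (K6)/(★^H) input, site form);
* `SiteBHK3.siteSetClusterCondPosAssoc` — site Thm 1.3 with a source SET `S` given `{S ↮ T}`.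

Support file (`--supports stmt-CriticalPhenomena-4575 --as helper`); sorry-free; no `Prop` definitions.
[cite: VandenbergHaggstromKahn2005, Thm. 2.1 (p. 9) at q = 1, Remark 1 after Thm. 1.2 (p. 5), Thms. 1.3–1.5]
[cite: KozmaNitzan2024, §2.2 (p. 5) ("Theorem (BHK)")]
-/

noncomputable section

namespace Summit.CriticalPhenomena.PercolationContinuityZ3.Theorems.Transplant

namespace SiteBHK3

open MeasureTheory unitInterval
open Literature.Probability.LatticeModels (prodBernoulli prodBernoulli_eq_map prodBernoulli_real_setOf_notMem)
open Literature.Probability.Percolation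
open Literature.Probability.Percolation.TwoSetConditionalAssociation (sides sides_true sides_false)
open scoped Classical

variable {V : Type*} (Γ : SimpleGraph V)

/-! ### The hub graph, hub weights and hub configuration -/

/-- The hub graph on `V ⊕ Bool`: the old graph on `inl`, and the hub `inr b` joined to every vertex
of `side b` ("identify the vertices of `X`", BHK Remark 1). [cite: VandenbergHaggstromKahn2005, Remark 1 after Thm. 1.2 (p. 5)] -/
def hubGraph (side : Bool → Set V) : SimpleGraph (V ⊕ Bool) :=
  SimpleGraph.fromRel fun x y =>
    (∃ u v, x = Sum.inl u ∧ y = Sum.inl v ∧ Γ.Adj u v) ∨ (∃ u b, x = Sum.inl u ∧ y = Sum.inr b ∧ u ∈ side b)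

/-- Hub weights: the old weights on `V`, weight `1` on the hubs. [folklore] -/
def hubQ (q : V → unitInterval) : V ⊕ Bool → unitInterval := Sum.elim q fun _ => 1

/-- The hub configuration of `ω`: the old open vertices and both hubs. [folklore] -/
def hubCfg (ω : Set V) : Set (V ⊕ Bool) := {x | Sum.elim (· ∈ ω) (fun _ => True) x}

/-- Restriction to the old coordinates. [folklore] -/
def resV (ω' : Set (V ⊕ Bool)) : Set V := Sum.inl ⁻¹' ω'

variable {Γ}

/-- An old vertex is open in the hub configuration iff it is open. [folklore] -/
@[simp] theorem inl_mem_hubCfg (ω : Set V) (u : V) : (Sum.inl u : V ⊕ Bool) ∈ hubCfg ω ↔ u ∈ ω := Iff.rfl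
/-- The hubs are open in the hub configuration. [folklore] -/
@[simp] theorem inr_mem_hubCfg (ω : Set V) (b : Bool) : (Sum.inr b : V ⊕ Bool) ∈ hubCfg ω := trivial
/-- Restricting the hub configuration gives back the configuration. [folklore] -/
@[simp] theorem resV_hubCfg (ω : Set V) : resV (hubCfg ω) = ω := rfl

/-- Old vertices are adjacent in the hub graph iff they are adjacent in `Γ`. [folklore] -/
theorem hubGraph_adj_inl_inl {side : Bool → Set V} {u v : V} :
    (hubGraph Γ side).Adj (Sum.inl u) (Sum.inl v) ↔ Γ.Adj u v := by
  simp only [hubGraph, SimpleGraph.fromRel_adj, ne_eq, Sum.inl.injEq, reduceCtorEq, and_false,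
    false_and, exists_false, or_false]
  constructor
  · rintro ⟨_, ⟨a, b, rfl, rfl, h⟩ | ⟨a, b, rfl, rfl, h⟩⟩
    · exact h
    · exact h.symm
  · intro h
    exact ⟨fun h' => h.ne h', Or.inl ⟨u, v, rfl, rfl, h⟩⟩

/-- `inl u ∼ inr b` iff `u ∈ side b`. [folklore] -/
theorem hubGraph_adj_inl_inr {side : Bool → Set V} {u : V} {b : Bool} :
    (hubGraph Γ side).Adj (Sum.inl u) (Sum.inr b) ↔ u ∈ side b := by
  simp only [hubGraph, SimpleGraph.fromRel_adj, ne_eq, reduceCtorEq, not_false_eq_true, Sum.inl.injEq,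
    Sum.inr.injEq, and_false, false_and, exists_false, false_or, or_false, true_and]
  constructor
  · rintro ⟨a, b', rfl, rfl, h⟩; exact h
  · intro h; exact ⟨u, b, rfl, rfl, h⟩

/-- `inr b ∼ inl u` iff `u ∈ side b`. [folklore] -/
theorem hubGraph_adj_inr_inl {side : Bool → Set V} {u : V} {b : Bool} :
    (hubGraph Γ side).Adj (Sum.inr b) (Sum.inl u) ↔ u ∈ side b := by
  rw [SimpleGraph.adj_comm, hubGraph_adj_inl_inr]

/-- The hubs are not adjacent. [folklore] -/
theorem not_hubGraph_adj_inr_inr {side : Bool → Set V} {b b' : Bool} :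
    ¬ (hubGraph Γ side).Adj (Sum.inr b) (Sum.inr b') := by
  simp [hubGraph, SimpleGraph.fromRel_adj]

/-! ### The law of the hub model -/

variable [Fintype V]

omit [Fintype V] in
/-- Marginal on the old coordinates: `prodBernoulli (hubQ q)` restricted along `inl` is `prodBernoulli q`. [folklore] -/
private theorem map_resV_prodBernoulli_hubQ (q : V → unitInterval) :
    (prodBernoulli (hubQ q)).map resV = prodBernoulli q := by
  have hmeas : Measurable (resV : Set (V ⊕ Bool) → Set V) :=
    measurable_set_iff.2 fun a => measurable_set_mem (Sum.inl a)
  have hpre : Measurable fun (f : V ⊕ Bool → Prop) (a : V) => f (Sum.inl a) :=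
    measurable_pi_lambda _ fun a => measurable_pi_apply (Sum.inl a)
  have hcomm : (resV : Set (V ⊕ Bool) → Set V) ∘ (fun f : V ⊕ Bool → Prop => {i | f i}) =
      (fun f : V → Prop => {a | f a}) ∘ (fun (f : V ⊕ Bool → Prop) (a : V) => f (Sum.inl a)) := rfl
  rw [prodBernoulli_eq_map, Measure.map_map hmeas measurable_setOf, hcomm,
    ← Measure.map_map measurable_setOf hpre, Measure.map_infinitePi_infinitePi_of_inj Sum.inl_injective,
    prodBernoulli_eq_map]
  rfl

omit [Fintype V] in
/-- Almost surely both hubs are open (weight `1`), i.e. the configuration is the hub configuration of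
its restriction. [folklore] -/
private theorem ae_hubCfg_resV_eq (q : V → unitInterval) :
    ∀ᵐ ω' ∂(prodBernoulli (hubQ q)), hubCfg (resV ω') = ω' := by
  have hb : ∀ b : Bool, ∀ᵐ ω' ∂(prodBernoulli (hubQ q)), (Sum.inr b : V ⊕ Bool) ∈ ω' := by
    intro b
    rw [ae_iff]
    have h := prodBernoulli_real_setOf_notMem (hubQ q) (Sum.inr b)
    have h1 : ((hubQ q (Sum.inr b) : unitInterval) : ℝ) = 1 := rfl
    rw [h1, sub_self] at h
    exact (measureReal_eq_zero_iff (measure_ne_top _ _)).1 h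
  filter_upwards [hb true, hb false] with ω' ht hf
  ext x
  rcases x with u | b
  · rfl
  · cases b
    · simpa using hf
    · simpa using ht

/-- The law of the hub model is the image of `prodBernoulli q` under `hubCfg`. [folklore] -/
private theorem prodBernoulli_hubQ_eq_map (q : V → unitInterval) :
    prodBernoulli (hubQ q) = (prodBernoulli q).map (hubCfg : Set V → Set (V ⊕ Bool)) := by
  have hres : Measurable (resV : Set (V ⊕ Bool) → Set V) := Measurable.of_discrete
  have haug : Measurable (hubCfg : Set V → Set (V ⊕ Bool)) := Measurable.of_discrete
  calc prodBernoulli (hubQ q)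
      = (prodBernoulli (hubQ q)).map id := Measure.map_id.symm
    _ = (prodBernoulli (hubQ q)).map (hubCfg ∘ resV) :=
        Measure.map_congr (by filter_upwards [ae_hubCfg_resV_eq q] with ω' h using h.symm)
    _ = ((prodBernoulli (hubQ q)).map resV).map hubCfg := (Measure.map_map haug hres).symm
    _ = (prodBernoulli q).map hubCfg := by rw [map_resV_prodBernoulli_hubQ]

/-- Transport of set integrals to the original space. [folklore] -/
private theorem setIntegral_hub (q : V → unitInterval) (Φ : Set (V ⊕ Bool) → ℝ) (D' : Set (Set (V ⊕ Bool))) :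
    ∫ ω' in D', Φ ω' ∂(prodBernoulli (hubQ q)) = ∫ ω in hubCfg ⁻¹' D', Φ (hubCfg ω) ∂(prodBernoulli q) := by
  rw [prodBernoulli_hubQ_eq_map]
  exact setIntegral_map MeasurableSet.of_discrete (Measurable.of_discrete (f := Φ)).aestronglyMeasurable
    (Measurable.of_discrete (f := (hubCfg : Set V → Set (V ⊕ Bool)))).aemeasurable

/-- Transport of probabilities to the original space. [folklore] -/
private theorem measureReal_hub (q : V → unitInterval) (D' : Set (Set (V ⊕ Bool))) :
    (prodBernoulli (hubQ q)).real D' = (prodBernoulli q).real (hubCfg ⁻¹' D') := by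
  rw [prodBernoulli_hubQ_eq_map,
    map_measureReal_apply (Measurable.of_discrete (f := (hubCfg : Set V → Set (V ⊕ Bool)))) MeasurableSet.of_discrete]

/-! ### Site clusters in the hub configuration -/

omit [Fintype V] in
/-- Old open site paths are open site paths of the hub configuration. [folklore] -/
theorem hub_reachable_inl (side : Bool → Set V) {ω : Set V} {u v : V}
    (h : (siteOpenGraph Γ ω).Reachable u v) :
    (siteOpenGraph (hubGraph Γ side) (hubCfg ω)).Reachable (Sum.inl u) (Sum.inl v) := by
  refine h.map { toFun := Sum.inl, map_rel' := fun {a b} hab => ?_ }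
  rw [siteOpenGraph_adj] at hab ⊢
  exact ⟨hubGraph_adj_inl_inl.2 hab.1, hab.2.1, hab.2.2⟩

omit [Fintype V] in
/-- A vertex set containing `x` and closed under the adjacency of `G` contains everything reachable
from `x`. [folklore] -/
theorem mem_of_reachable_of_closed {α : Type*} {G : SimpleGraph α} {W : Set α}
    (hW : ∀ a b, a ∈ W → G.Adj a b → b ∈ W) {x y : α} (hx : x ∈ W) (h : G.Reachable x y) : y ∈ W := by
  rw [SimpleGraph.reachable_iff_reflTransGen] at h
  induction h with
  | refl => exact hx
  | tail _ hbc ih => exact hW _ _ ih hbc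

omit [Fintype V] in
/-- **The cluster of a hub**, when the hubs are not joined: every vertex reachable from `inr b` in the
hub configuration is `inr b` itself or `inl v` with `v` in the site cluster of some OPEN `s ∈ side b`.
[cite: VandenbergHaggstromKahn2005, Remark 1 after Thm. 1.2 (p. 5)] -/
theorem hub_reachable_cases (side : Bool → Set V) (ω : Set V) (b : Bool)
    (hD : ∀ s ∈ side b, ∀ t ∈ side (!b), t ∉ siteCluster Γ ω s) {x : V ⊕ Bool}
    (hx : (siteOpenGraph (hubGraph Γ side) (hubCfg ω)).Reachable (Sum.inr b) x) :
    x = Sum.inr b ∨ ∃ v, x = Sum.inl v ∧ ∃ s ∈ side b, v ∈ siteCluster Γ ω s := by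
  let W : Set (V ⊕ Bool) := {x | x = Sum.inr b ∨ ∃ v, x = Sum.inl v ∧ ∃ s ∈ side b, v ∈ siteCluster Γ ω s}
  have hW : ∀ a c, a ∈ W → (siteOpenGraph (hubGraph Γ side) (hubCfg ω)).Adj a c → c ∈ W := by
    intro a c ha hac
    rw [siteOpenGraph_adj] at hac
    obtain ⟨hadj, hao, hco⟩ := hac
    rcases ha with rfl | ⟨v, rfl, s, hs, hv⟩
    · -- from the hub: `c = inl u` with `u ∈ side b` open
      rcases c with u | b'
      · have hu : u ∈ side b := hubGraph_adj_inr_inl.1 hadj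
        have huo : u ∈ ω := hco
        exact Or.inr ⟨u, rfl, u, hu, ⟨huo, huo, SimpleGraph.Reachable.refl u⟩⟩
      · exact absurd hadj not_hubGraph_adj_inr_inr
    · rcases c with u | b'
      · have huo : u ∈ ω := hco
        refine Or.inr ⟨u, rfl, s, hs, ?_⟩
        obtain ⟨hso, hvo, hr⟩ := hv
        exact ⟨hso, huo, hr.trans (SimpleGraph.Adj.reachable (by
          rw [siteOpenGraph_adj]; exact ⟨hubGraph_adj_inl_inl.1 hadj, hvo, huo⟩))⟩
      · -- into a hub: it must be `inr b` (the other hub would join `S` to `T`)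
        have hvb' : v ∈ side b' := hubGraph_adj_inl_inr.1 hadj
        by_cases hbb : b' = b
        · exact Or.inl (by rw [hbb])
        · exfalso
          have hb' : b' = !b := by cases b <;> cases b' <;> simp_all
          exact hD s hs v (hb' ▸ hvb') hv
  exact mem_of_reachable_of_closed hW (Or.inl rfl) hx

omit [Fintype V] in
/-- **`{s* ↮ t*}` pulls back to `{S ↮ T}`.** [cite: VandenbergHaggstromKahn2005, Remark 1 after Thm. 1.2 (p. 5)] -/
theorem hubCfg_preimage_not_reachable (S T : Set V) :
    (hubCfg : Set V → Set (V ⊕ Bool)) ⁻¹'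
        {ω' | (Sum.inr false : V ⊕ Bool) ∉ siteCluster (hubGraph Γ (sides S T)) ω' (Sum.inr true)} =
      {ω | ∀ s ∈ S, ∀ t ∈ T, t ∉ siteCluster Γ ω s} := by
  ext ω
  simp only [Set.preimage_setOf_eq, Set.mem_setOf_eq, siteCluster, inr_mem_hubCfg, true_and]
  constructor
  · intro h s hs t ht hts
    apply h
    obtain ⟨hso, hto, hr⟩ := hts
    have h1 : (siteOpenGraph (hubGraph Γ (sides S T)) (hubCfg ω)).Adj (Sum.inr true) (Sum.inl s) := by
      rw [siteOpenGraph_adj]; exact ⟨hubGraph_adj_inr_inl.2 hs, trivial, hso⟩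
    have h2 : (siteOpenGraph (hubGraph Γ (sides S T)) (hubCfg ω)).Adj (Sum.inl t) (Sum.inr false) := by
      rw [siteOpenGraph_adj]; exact ⟨hubGraph_adj_inl_inr.2 ht, hto, trivial⟩
    exact (h1.reachable.trans (hub_reachable_inl (sides S T) hr)).trans h2.reachable
  · intro h hr
    rcases hub_reachable_cases (sides S T) ω true (fun s hs t ht => h s hs t ht) hr with h0 | ⟨v, hv, _⟩
    · exact absurd h0 (by simp)
    · exact absurd hv (by simp)

omit [Fintype V] in
/-- **The hub clusters read on the old vertices are `C_S`, `C_T`** on `{S ↮ T}`.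
[cite: VandenbergHaggstromKahn2005, §2 p. 9 (`C_S`), Remark 1 after Thm. 1.2 (p. 5)] -/
theorem resV_siteCluster_hub (S T : Set V) (ω : Set V) (b : Bool)
    (hD : ∀ s ∈ sides S T b, ∀ t ∈ sides S T (!b), t ∉ siteCluster Γ ω s) :
    resV (siteCluster (hubGraph Γ (sides S T)) (hubCfg ω) (Sum.inr b)) = ⋃ s ∈ sides S T b, siteCluster Γ ω s := by
  ext v
  simp only [resV, Set.mem_preimage, Set.mem_iUnion, exists_prop]
  constructor
  · rintro ⟨_, _, hr⟩
    rcases hub_reachable_cases (sides S T) ω b hD hr with h0 | ⟨v', hv', s, hs, hv⟩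
    · exact absurd h0 (by simp)
    · simp only [Sum.inl.injEq] at hv'
      subst hv'
      exact ⟨s, hs, hv⟩
  · rintro ⟨s, hs, hso, hvo, hr⟩
    refine ⟨trivial, hvo, ?_⟩
    have h1 : (siteOpenGraph (hubGraph Γ (sides S T)) (hubCfg ω)).Adj (Sum.inr b) (Sum.inl s) := by
      rw [siteOpenGraph_adj]; exact ⟨hubGraph_adj_inr_inl.2 hs, trivial, hso⟩
    exact h1.reachable.trans (hub_reachable_inl (sides S T) hr)

omit [Fintype V] in
/-- `resV` is monotone. [folklore] -/
theorem resV_mono {C C' : Set (V ⊕ Bool)} (h : C ⊆ C') : resV C ⊆ resV C' := fun _ hv => h hv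

/-! ### Theorems 1.5 / 1.4 / 1.3 with sets -/

/-- **SITE vdBHK Thm 1.5 with vertex sets** (= site Thm 2.1 at q = 1): for `F, G` functions of
`(C_S, C_T)`, `C_S = ⋃_{s∈S} C_s` (site clusters), increasing in `C_S` and decreasing in `C_T`,
`(∫_D F)(∫_D G) ≤ P(D) ∫_D F G` with `D = {S ↮ T} = {∀ s ∈ S, ∀ t ∈ T, t ∉ C_s}` under `prodBernoulli q`.
OURS (print: bond/RCM only). [cite: VandenbergHaggstromKahn2005, Thm. 2.1 (p. 9) at q = 1; Remark 1 (p. 5)] -/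
theorem siteTwoSetCondAssoc (q : V → unitInterval) (S T : Set V) (F G : Set V → Set V → ℝ)
    (hF₁ : ∀ D, Monotone fun C => F C D) (hF₂ : ∀ C, Antitone fun D => F C D)
    (hG₁ : ∀ D, Monotone fun C => G C D) (hG₂ : ∀ C, Antitone fun D => G C D) :
    (∫ ω in {ω | ∀ s ∈ S, ∀ t ∈ T, t ∉ siteCluster Γ ω s},
        F (⋃ s ∈ S, siteCluster Γ ω s) (⋃ t ∈ T, siteCluster Γ ω t) ∂(prodBernoulli q)) *
      (∫ ω in {ω | ∀ s ∈ S, ∀ t ∈ T, t ∉ siteCluster Γ ω s},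
        G (⋃ s ∈ S, siteCluster Γ ω s) (⋃ t ∈ T, siteCluster Γ ω t) ∂(prodBernoulli q)) ≤
    (prodBernoulli q).real {ω | ∀ s ∈ S, ∀ t ∈ T, t ∉ siteCluster Γ ω s} *
      ∫ ω in {ω | ∀ s ∈ S, ∀ t ∈ T, t ∉ siteCluster Γ ω s},
        F (⋃ s ∈ S, siteCluster Γ ω s) (⋃ t ∈ T, siteCluster Γ ω t) *
          G (⋃ s ∈ S, siteCluster Γ ω s) (⋃ t ∈ T, siteCluster Γ ω t) ∂(prodBernoulli q) := by
  set D : Set (Set V) := {ω | ∀ s ∈ S, ∀ t ∈ T, t ∉ siteCluster Γ ω s} with hD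
  have hDm : MeasurableSet D := MeasurableSet.of_discrete
  have key := SiteBHK2.siteTwoClusterCondAssoc (Γ := hubGraph Γ (sides S T)) (hubQ q)
    (Sum.inr true) (Sum.inr false)
    (fun C E => F (resV C) (resV E)) (fun C E => G (resV C) (resV E))
    (fun E _ _ h => hF₁ _ (resV_mono h)) (fun C _ _ h => hF₂ _ (resV_mono h))
    (fun E _ _ h => hG₁ _ (resV_mono h)) (fun C _ _ h => hG₂ _ (resV_mono h))
  simp only [setIntegral_hub, measureReal_hub] at key
  rw [hubCfg_preimage_not_reachable] at key
  have hT : ∀ ω ∈ D, ∀ s ∈ sides S T false, ∀ t ∈ sides S T (!false), t ∉ siteCluster Γ ω s := by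
    intro ω hω t ht s hs hst
    simp only [sides_false, Bool.not_false, sides_true] at ht hs
    -- `s ∈ C_t` with `s ∈ S`, `t ∈ T` gives `t ∈ C_s`
    obtain ⟨hto, hso, hr⟩ := hst
    exact hω s hs t ht ⟨hso, hto, hr.symm⟩
  have hC : ∀ ω ∈ D,
      resV (siteCluster (hubGraph Γ (sides S T)) (hubCfg ω) (Sum.inr true)) = ⋃ s ∈ S, siteCluster Γ ω s ∧
      resV (siteCluster (hubGraph Γ (sides S T)) (hubCfg ω) (Sum.inr false)) = ⋃ t ∈ T, siteCluster Γ ω t :=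
    fun ω hω => ⟨resV_siteCluster_hub S T ω true (fun s hs t ht => hω s hs t ht),
      resV_siteCluster_hub S T ω false (hT ω hω)⟩
  have e1 : ∫ ω in D, F (resV (siteCluster (hubGraph Γ (sides S T)) (hubCfg ω) (Sum.inr true)))
        (resV (siteCluster (hubGraph Γ (sides S T)) (hubCfg ω) (Sum.inr false))) ∂(prodBernoulli q) =
      ∫ ω in D, F (⋃ s ∈ S, siteCluster Γ ω s) (⋃ t ∈ T, siteCluster Γ ω t) ∂(prodBernoulli q) :=
    setIntegral_congr_fun hDm fun ω hω => by rw [(hC ω hω).1, (hC ω hω).2]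
  have e2 : ∫ ω in D, G (resV (siteCluster (hubGraph Γ (sides S T)) (hubCfg ω) (Sum.inr true)))
        (resV (siteCluster (hubGraph Γ (sides S T)) (hubCfg ω) (Sum.inr false))) ∂(prodBernoulli q) =
      ∫ ω in D, G (⋃ s ∈ S, siteCluster Γ ω s) (⋃ t ∈ T, siteCluster Γ ω t) ∂(prodBernoulli q) :=
    setIntegral_congr_fun hDm fun ω hω => by rw [(hC ω hω).1, (hC ω hω).2]
  have e3 : ∫ ω in D, F (resV (siteCluster (hubGraph Γ (sides S T)) (hubCfg ω) (Sum.inr true)))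
        (resV (siteCluster (hubGraph Γ (sides S T)) (hubCfg ω) (Sum.inr false))) *
        G (resV (siteCluster (hubGraph Γ (sides S T)) (hubCfg ω) (Sum.inr true)))
        (resV (siteCluster (hubGraph Γ (sides S T)) (hubCfg ω) (Sum.inr false))) ∂(prodBernoulli q) =
      ∫ ω in D, F (⋃ s ∈ S, siteCluster Γ ω s) (⋃ t ∈ T, siteCluster Γ ω t) *
        G (⋃ s ∈ S, siteCluster Γ ω s) (⋃ t ∈ T, siteCluster Γ ω t) ∂(prodBernoulli q) :=
    setIntegral_congr_fun hDm fun ω hω => by rw [(hC ω hω).1, (hC ω hω).2]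
  rw [e1, e2, e3] at key
  exact key

/-- **SITE vdBHK Thm 1.4 with vertex sets** — the form consumed by the chain's (K6)/(★^H) links
(Kozma–Nitzan §2.2 "`E(fg | A ↮ B) ≤ E(f | A ↮ B) E(g | A ↮ B)`"), site model: for `F, G` increasing,
`P(D) ∫_D F(C_S) G(C_T) ≤ (∫_D F(C_S))(∫_D G(C_T))`, `D = {S ↮ T}`. OURS.
[cite: VandenbergHaggstromKahn2005, Thm. 1.4 (p. 7) with Remark 1 (p. 5)] [cite: KozmaNitzan2024, §2.2 (p. 5)] -/
theorem siteTwoSet_negCorrelation (q : V → unitInterval) (S T : Set V) (F G : Set V → ℝ)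
    (hF : Monotone F) (hG : Monotone G) :
    (prodBernoulli q).real {ω | ∀ s ∈ S, ∀ t ∈ T, t ∉ siteCluster Γ ω s} *
      (∫ ω in {ω | ∀ s ∈ S, ∀ t ∈ T, t ∉ siteCluster Γ ω s},
        F (⋃ s ∈ S, siteCluster Γ ω s) * G (⋃ t ∈ T, siteCluster Γ ω t) ∂(prodBernoulli q)) ≤
    (∫ ω in {ω | ∀ s ∈ S, ∀ t ∈ T, t ∉ siteCluster Γ ω s}, F (⋃ s ∈ S, siteCluster Γ ω s) ∂(prodBernoulli q)) *
      ∫ ω in {ω | ∀ s ∈ S, ∀ t ∈ T, t ∉ siteCluster Γ ω s}, G (⋃ t ∈ T, siteCluster Γ ω t) ∂(prodBernoulli q) := by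
  have key := siteTwoSetCondAssoc (Γ := Γ) q S T (fun C _ => F C) (fun _ D => -G D)
    (fun _ => hF) (fun _ => antitone_const) (fun _ => monotone_const) (fun _ _ _ hDD' => neg_le_neg (hG hDD'))
  simp only [mul_neg, integral_neg] at key
  linarith

/-- **SITE vdBHK Thm 1.3 / 1.2 with a source SET `S`** (Kozma–Nitzan's "Theorem (BHK)", site model):
for `F, G` increasing functions of `C_S`, `(∫_D F)(∫_D G) ≤ P(D) ∫_D F G`, `D = {S ↮ T}`. OURS.
[cite: VandenbergHaggstromKahn2005, Thm. 1.3 (p. 6) with Remark 1 (p. 5)] [cite: KozmaNitzan2024, §2.2 (p. 5)] -/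
theorem siteSetClusterCondPosAssoc (q : V → unitInterval) (S T : Set V) (F G : Set V → ℝ)
    (hF : Monotone F) (hG : Monotone G) :
    (∫ ω in {ω | ∀ s ∈ S, ∀ t ∈ T, t ∉ siteCluster Γ ω s}, F (⋃ s ∈ S, siteCluster Γ ω s) ∂(prodBernoulli q)) *
      (∫ ω in {ω | ∀ s ∈ S, ∀ t ∈ T, t ∉ siteCluster Γ ω s}, G (⋃ s ∈ S, siteCluster Γ ω s) ∂(prodBernoulli q)) ≤
    (prodBernoulli q).real {ω | ∀ s ∈ S, ∀ t ∈ T, t ∉ siteCluster Γ ω s} *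
      ∫ ω in {ω | ∀ s ∈ S, ∀ t ∈ T, t ∉ siteCluster Γ ω s},
        F (⋃ s ∈ S, siteCluster Γ ω s) * G (⋃ s ∈ S, siteCluster Γ ω s) ∂(prodBernoulli q) :=
  siteTwoSetCondAssoc (Γ := Γ) q S T (fun C _ => F C) (fun C _ => G C) (fun _ => hF)
    (fun _ => antitone_const) (fun _ => hG) (fun _ => antitone_const)

end SiteBHK3

end Summit.CriticalPhenomena.PercolationContinuityZ3.Theorems.Transplant
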